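import Summits.ResolutionOfSingularities.ResolutionOfSingularities.Theorems.FrobeniusLadderFInjectiveMacaulayficationP3d4z4557PointFloorRowClass
import Summits.ResolutionOfSingularities.ResolutionOfSingularities.Theorems.FrobeniusLadderFInjectiveMacaulayficationF108ClassRowAnyField
import Mathlib.FieldTheory.IsAlgClosed.AlgebraicClosure
import HarnessLib

/-!
# GAP-2 «k ≠ k̄»: THE CENSUS BED BED W `z³ + x⁴ + y⁵ + u⁵ + t⁷` (char 3, wild vertex `z³`) — POINT-FLOOR ROW AND GERM OVER ANY FIELD OF CHARACTERISTIC 3 (any-field twins of ✓ `…P3d4z4557PointFloorRowClass`)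
# (crux `FInjectiveMacaulayfication` stmt-ResolutionOfSingularities-15315, chain w45a; seat res-L1-w45a-stub-2 g12; res-L1-w45a-plan-1 GO 2026-08-29T02:44:48Z
# «the H_F class level over EVERY field of characteristic p … then thin any-field rows per census bed»)

[OURS · L1 W4.5a] Support file (`--supports stmt-ResolutionOfSingularities-15315 --as helper`); def-free, unconditional; replaces the role of NO printed item; NOT a statement
of the manuscript; AI-written (AI review is weaker than expert review). OURS counted 0; nothing of the crux is proved.

The theorems of ✓ `…P3d4z4557PointFloorRowClass` that carried `[IsAlgClosed k]` and are NOT already field-general elsewhere are re-proved here WITHOUT it (the two-sided row itself is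
already any-field by the cells route ✓ `P3d4z4557PointFloorRow.f4pos_row_p3_one` — not restated; kept: FULL-everywhere of `Bl_{𝔪·K}` and the germ form by the CLASS route), for EVERY field `k` of characteristic 3: the callees
`FHalfRowOfNewtonNondegenerate.*` / `F108ClassRow.*_of_convenient*` (k = k̄) are swapped for this seat's any-field twins `FHalfRowAnyField.*_of_geomWeaklyNondegenerate` /
`F108ClassRowAnyField.*_of_convenient_anyField*` (✓ `…FHalfRowOfWeaklyNondegenerateAnyField`, ✓ `…F108ClassRowAnyField`), whose one changed hypothesis — GEOMETRIC weak
non-degeneracy, i.e. weak non-degeneracy of `map (algebraMap k K) f` over an algebraically closed `K ⊇ k` — is supplied by the bed's field-general Specimen lemma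
`CensusBedsWeaklyNondegenerate.weaklyNondegenerate_bedW` at `K := AlgebraicClosure k` (`geom_weaklyNondegenerate`). The field-general lemmas of the original file (strict transforms, shift identity,
convenience, input side LEGAL / NOT FULL) are imported, not restated. Proof texts are otherwise the originals byte-for-byte.
SCOPE (desk caveat, binding): the vertex is the `k`-RATIONAL origin; closed points with residue field a proper extension of `k` are not addressed (GAP-2).
[OURS · thin application of landed theorems] [cite: IshiiSingularities2018, Thm. 4.4.23; Fedder1983, Thm. 1.12; StacksProject, Tag 080A; GortzWedhorn2020, Prop. 13.91 (2), (13.19)]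
-/

-- single-problem summit: the doubled namespace component is forced
set_option linter.dupNamespace false

noncomputable section

open AlgebraicGeometry CategoryTheory Literature.AlgebraicGeometry.Resolution TopologicalSpace IsLocalRing MvPolynomial

namespace Summit.ResolutionOfSingularities.ResolutionOfSingularities.Theorems.FInjectiveMacaulayfication.P3d4z4557PointFloorRowAnyField

open Summit.ResolutionOfSingularities.ResolutionOfSingularities.Theorems.FInjectiveMacaulayfication
open SliceableCentre FanCheckKit P3d4z4557NewtonKFan
open Literature.AlgebraicGeometry.Resolution.BoubakriGreuelMarkwig P3d4z4557PointFloorRowClass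

/-- **GEOMETRIC weak non-degeneracy of the (shifted) bed over ANY field of characteristic 3**: the field-general lemma `CensusBedsWeaklyNondegenerate.weaklyNondegenerate_bedW`, applied over `AlgebraicClosure k` to `map (algebraMap k _) f` (which is the same polynomial expression). [OURS · plumbing] -/
theorem geom_weaklyNondegenerate (k : Type) [Field k] [CharP k 3] (f : MvPolynomial (Fin 5) k)
    (hf : f = X 4 ^ 3 + X 0 ^ 4 + X 1 ^ 5 + X 2 ^ 5 + X 3 ^ 7) :
    ∀ w : Fin 5 → ℝ, (∀ i, 0 < w i) →
      IsWeaklyNondegenerateAlong w ((map (algebraMap k (AlgebraicClosure k)) f : MvPolynomial (Fin 5) (AlgebraicClosure k)) :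
        MvPowerSeries (Fin 5) (AlgebraicClosure k)) := by
  haveI : CharP (AlgebraicClosure k) 3 := charP_of_injective_algebraMap (algebraMap k (AlgebraicClosure k)).injective 3
  refine CensusBedsWeaklyNondegenerate.weaklyNondegenerate_bedW (AlgebraicClosure k) _ ?_
  subst hf
  simp


/-- ANY-FIELD TWIN (GAP-2 «k ≠ k̄»; `[IsAlgClosed k]` dropped, geometric weak non-degeneracy via `AlgebraicClosure k`): ★ **`Bl_{𝔪·K} X_W` IS FULL AT EVERY POINT** (class route: weak non-degeneracy + Newton fan cover data; no Fedder cell). [OURS · certificate instance]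
[cite: IshiiSingularities2018, Thm. 4.4.23 and Cor. 4.4.25] -/
theorem affineBlowup_mK_fullCl_anyField (k : Type) [Field k] [CharP k 3] (f : MvPolynomial (Fin 5) k)
    (hf : f = X 4 ^ 3 + X 0 ^ 4 + X 1 ^ 5 + X 2 ^ 5 + X 3 ^ 7) :
    ∀ y : ↥(affineBlowup (Ideal.span ((fun e : Fin 5 →₀ ℕ => Ideal.Quotient.mk (Ideal.span {f}) (monomial e (1 : k))) '' (genSet 5 AL2 : Set (Fin 5 →₀ ℕ))))),
      FullCl 3 ((affineBlowup (Ideal.span ((fun e : Fin 5 →₀ ℕ => Ideal.Quotient.mk (Ideal.span {f}) (monomial e (1 : k))) '' (genSet 5 AL2 : Set (Fin 5 →₀ ℕ))))).presheaf.stalk y) := by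
  classical
  haveI : Fact (Nat.Prime 3) := ⟨Nat.prime_three⟩
  choose g hθ hg0 using exists_refining_strictTransform k f hf
  exact FHalfRowAnyField.affineBlowup_fullCl_of_geomWeaklyNondegenerate 3 k (AlgebraicClosure k) f (P3d4z4557Specimen.prime_f k f hf)
    (geom_weaklyNondegenerate k f hf) (P3d4z4557PointKBlowupFull.mk_X_ne_zero_all k f hf)
    (fun x hx => P3d4z4557Specimen.regular_off_vertex k f hf x.asIdeal hx)
    (genSet 5 AL2) hprimAJ.2.1 hprimAJ.1 441 (chartM 5 AL2 CL 441) (hcov k) Vq hV (chartA 5 AL2 CL 441) haA hgen hge g _ hθ hg0 (P3d4z4557NewtonKFan.hv k _)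

/-- ANY-FIELD TWIN (GAP-2 «k ≠ k̄»; `[IsAlgClosed k]` dropped, geometric weak non-degeneracy via `AlgebraicClosure k`): ★ **THE GERM TWIN**: `FInjectivizationGermAt 3 v` — the F-half's ∃-conclusion at the germ of `X_W` at its vertex, witnessed by `(𝔪·K)·𝒪_{X,v}` (all of whose blowings up are
FULL everywhere by §1; `𝔪·K ≠ ⊥` and `𝔪 ⊆ √(𝔪·K)` from the pure powers in `A`). [OURS · certificate instance; cite: GortzWedhorn2020, Prop. 13.91 (2)] -/
theorem p3d4z4557_fInjectivizationGermAt_anyField (k : Type) [Field k] [CharP k 3] (f : MvPolynomial (Fin 5) k)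
    (hf : f = X 4 ^ 3 + X 0 ^ 4 + X 1 ^ 5 + X 2 ^ 5 + X 3 ^ 7)
    (v : Spec (.of (MvPolynomial (Fin 5) k ⧸ Ideal.span {f})))
    (hv : v.asIdeal = Ideal.span (Set.range (fun j : Fin 5 => Ideal.Quotient.mk (Ideal.span {f}) (X j)))) :
    GermForm.FInjectivizationGermAt 3 v := by
  classical
  have hprime := P3d4z4557Specimen.prime_f k f hf
  haveI hp : (Ideal.span {f}).IsPrime := (Ideal.span_singleton_prime hprime.ne_zero).mpr hprime
  haveI : IsDomain (MvPolynomial (Fin 5) k ⧸ Ideal.span {f}) := Ideal.Quotient.isDomain _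
  refine GermOfGlobalBlowup.fInjectivizationGermAt_of_affineBlowup 3 _ ?_ v ?_ (affineBlowup_mK_fullCl_anyField k f hf)
  · obtain ⟨N, hN⟩ := hprimAJ.2.1 0 (Finset.mem_univ _)
    intro h0
    have hmem : Ideal.Quotient.mk (Ideal.span {f}) (monomial (Finsupp.single 0 N) (1 : k)) ∈
        Ideal.span ((fun e : Fin 5 →₀ ℕ => Ideal.Quotient.mk (Ideal.span {f}) (monomial e (1 : k))) '' (genSet 5 AL2 : Set (Fin 5 →₀ ℕ))) :=
      Ideal.subset_span ⟨_, Finset.mem_coe.mpr hN, rfl⟩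
    rw [h0, Ideal.mem_bot, ← X_pow_eq_monomial, map_pow] at hmem
    exact pow_ne_zero N (P3d4z4557PointKBlowupFull.mk_X_ne_zero_all k f hf 0) hmem
  · rw [hv, Ideal.span_le]
    rintro _ ⟨j, rfl⟩
    obtain ⟨N, hN⟩ := hprimAJ.2.1 j (Finset.mem_univ _)
    exact ⟨N, by rw [← map_pow, X_pow_eq_monomial]; exact Ideal.subset_span ⟨_, Finset.mem_coe.mpr hN, rfl⟩⟩

end Summit.ResolutionOfSingularities.ResolutionOfSingularities.Theorems.FInjectiveMacaulayfication.P3d4z4557PointFloorRowAnyField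

end
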